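import Mathlib
import Summits.Ventures.PercRepro2.HCov
import Summits.Ventures.PercRepro2.HCovCubic
import Summits.Ventures.PercRepro2.HCovSwap
import Summits.Ventures.PercRepro2.TriDisagreement
import Summits.Ventures.PercRepro2.TriDisagreementPinned
import Summits.Ventures.PercRepro2.RootCoincidence

/-!
# Typed bases of a vanishing covariance form vanish — typed root coincidence (blind cell
PercRepro2, p1 g11; the one lemma the typed bridge needs beyond night-3's calculus, P1-CCWBRIDGE §9)

The typed bases `typedCount F z τ K₃` are the Bernstein coefficients of the polynomial
`p ↦ Gc p` on the face of the cube cut out by `z` off `F`. If `Gc ≡ 0` as a function of the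
weights, every coefficient is `0` — the Bernstein polynomials are a basis. Proof: induction on
`F` along the pinning recursion — at an edge `f`, `t ↦ triSum p[f↦t] F₀ τ K` is the cubic
`(1 − t)³ A₀ + t³ A₃ + t (1 − t)² D₁ + t² (1 − t) D₂` (`triSum_pin` + the factorisation
`triSum_factor_swap`), and a cubic vanishing at `t = 0, 1, 1/3, 2/3` has all four coefficients zero.

* **`triSum_factor_swap`**: the weight factor of a typed edge comes out of the typed sum;
* **`triSum_eq_zero_of_forall`**: if the cubic form vanishes for every weight vector agreeing with
  `q` off `F`, every typed sum over `F` at such weights vanishes;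
* **`typedCount_eq_zero_of_Gc_eq_zero`**: `(∀ p, Gc p = 0) → typedCount F z τ K₃ = 0`;
* **`typedCount_eq_zero_of_o_eq_a1`**, `…_a3_eq_a1`, `…_b_eq_a1`, `…_a2_eq_a1` and the `a₂`
  versions — the typed forms of `RootCoincidence`: contracting a pinned-open edge from a root into
  another mark kills every typed base.
-/

namespace Summit.Ventures.PercRepro2

open CovForm

namespace TypedVanish

section Factor

variable {E : Type*} [Fintype E] [DecidableEq E] {R : Type*} [CommRing R]

/-- The weight of a configuration, with the factor of `f` separated, only sees the weight vector
off `f` through the other factors. -/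
lemma weight_mul_factor_swap (q q' : E → R) {f : E} (hqq' : ∀ g, g ≠ f → q g = q' g) (ω : Config E) :
    weight q ω * edgeFactor (q' f) (ω f) = weight q' ω * edgeFactor (q f) (ω f) := by
  rw [weight_eq_mul_edgeFactor q ω f, weight_eq_mul_edgeFactor q' ω f]
  have : (∏ e' ∈ Finset.univ.erase f, edgeFactor (q e') (ω e')) =
      ∏ e' ∈ Finset.univ.erase f, edgeFactor (q' e') (ω e') :=
    Finset.prod_congr rfl fun e' he' => by rw [hqq' e' (Finset.ne_of_mem_erase he')]
  rw [this]
  ring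

/-- **Factorisation at a typed edge**: for `f ∈ F`, the typed sums at two weight vectors agreeing
off `f` are proportional to the Bernstein factors of `f`. -/
theorem triSum_factor_swap (q q' : E → R) {f : E} (hqq' : ∀ g, g ≠ f → q g = q' g) (F : Finset E)
    (hf : f ∈ F) (τ : E → ℕ) (K : Config E → Config E → Config E → R) :
    triSum q F τ K * (q' f ^ τ f * (1 - q' f) ^ (3 - τ f)) =
      triSum q' F τ K * (q f ^ τ f * (1 - q f) ^ (3 - τ f)) := by
  unfold triSum
  simp only [Finset.sum_mul]
  refine Finset.sum_congr rfl fun x _ => Finset.sum_congr rfl fun y _ =>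
    Finset.sum_congr rfl fun w _ => ?_
  by_cases hc : ∀ e ∈ F, openCount x y w e = τ e
  · rw [if_pos hc, if_pos hc]
    have hcf := hc f hf
    unfold openCount at hcf
    rw [← hcf, ← edgeFactor_three, ← edgeFactor_three]
    have h1 := weight_mul_factor_swap q q' hqq' x
    have h2 := weight_mul_factor_swap q q' hqq' y
    have h3 := weight_mul_factor_swap q q' hqq' w
    calc weight q x * weight q y * weight q w * K x y w *
          (edgeFactor (q' f) (x f) * edgeFactor (q' f) (y f) * edgeFactor (q' f) (w f))
        = (weight q x * edgeFactor (q' f) (x f)) * (weight q y * edgeFactor (q' f) (y f)) *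
            (weight q w * edgeFactor (q' f) (w f)) * K x y w := by ring
      _ = (weight q' x * edgeFactor (q f) (x f)) * (weight q' y * edgeFactor (q f) (y f)) *
            (weight q' w * edgeFactor (q f) (w f)) * K x y w := by rw [h1, h2, h3]
      _ = _ := by ring
  · rw [if_neg hc, if_neg hc, zero_mul, zero_mul]

/-- A typed sum with a type above `3` is empty. -/
lemma triSum_eq_zero_of_three_lt (q : E → R) (F : Finset E) (τ : E → ℕ)
    (K : Config E → Config E → Config E → R) {f : E} (hf : f ∈ F) (h3 : 3 < τ f) :
    triSum q F τ K = 0 := by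
  unfold triSum
  refine Finset.sum_eq_zero fun x _ => Finset.sum_eq_zero fun y _ => Finset.sum_eq_zero fun w _ => ?_
  rw [if_neg]
  intro hc
  have := hc f hf
  have := openCount_le_three x y w f
  omega

end Factor

section Vanish

variable {E : Type*} [Fintype E] [DecidableEq E] {R : Type*} [Field R] [LinearOrder R]
  [IsStrictOrderedRing R]

/-- **A vanishing cubic form has vanishing typed sums**: if `triSum q' ∅ τ₀ K = 0` for every `q'`
agreeing with `q` off `F`, then `triSum q F τ K = 0` for every type map `τ`. -/
theorem triSum_eq_zero_of_forall (K : Config E → Config E → Config E → R) (τ₀ : E → ℕ)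
    (F : Finset E) :
    ∀ (q : E → R), (∀ q' : E → R, (∀ g, g ∉ F → q' g = q g) → triSum q' ∅ τ₀ K = 0) →
      ∀ τ : E → ℕ, triSum q F τ K = 0 := by
  induction F using Finset.induction_on with
  | empty =>
    intro q hq τ
    have := hq q (fun _ _ => rfl)
    rwa [triSum_empty] at this ⊢
  | @insert f F₀ hfF₀ ih =>
    intro q hq τ
    -- the typed sums over `F₀` vanish at every weight of `f`
    have hF₀ : ∀ t : R, triSum (Function.update q f t) F₀ τ K = 0 := by
      intro t
      refine ih (Function.update q f t) (fun q' hq' => hq q' fun g hg => ?_) τ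
      have hgf : g ≠ f := fun h => hg (h ▸ Finset.mem_insert_self f F₀)
      rw [hq' g (fun h => hg (Finset.mem_insert_of_mem h)), Function.update_of_ne hgf]
    -- the cubic in `t`
    have hsplit : ∀ t : R, triSum (Function.update q f t) F₀ τ K =
        (1 - t) ^ 3 * triSum (Function.update q f 0) F₀ τ K +
          t ^ 3 * triSum (Function.update q f 1) F₀ τ K +
          triSum (Function.update q f t) (insert f F₀) (Function.update τ f 1) K +
          triSum (Function.update q f t) (insert f F₀) (Function.update τ f 2) K := by
      intro t
      rw [triSum_pin (Function.update q f t) hfF₀ τ K, Function.update_idem, Function.update_idem,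
        Function.update_self]
    -- the mixed pieces at `t` are the Bernstein factors times the pieces at `t = 1/2`
    have hfac : ∀ (t : R) (j : ℕ), triSum (Function.update q f t) (insert f F₀)
        (Function.update τ f j) K * ((1 / 2 : R) ^ j * (1 - 1 / 2) ^ (3 - j)) =
        triSum (Function.update q f (1 / 2)) (insert f F₀) (Function.update τ f j) K *
          (t ^ j * (1 - t) ^ (3 - j)) := by
      intro t j
      have := triSum_factor_swap (Function.update q f t) (Function.update q f (1 / 2))
        (f := f) (fun g hg => by rw [Function.update_of_ne hg, Function.update_of_ne hg])
        (insert f F₀) (Finset.mem_insert_self f F₀) (Function.update τ f j) K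
      simpa using this
    have hA₀ := hF₀ 0
    have hA₃ := hF₀ 1
    have h13 := hF₀ (1 / 3)
    have h23 := hF₀ (2 / 3)
    rw [hsplit, hA₀, hA₃] at h13 h23
    have e13a := hfac (1 / 3) 1
    have e13b := hfac (1 / 3) 2
    have e23a := hfac (2 / 3) 1
    have e23b := hfac (2 / 3) 2
    norm_num at e13a e13b e23a e23b h13 h23
    have hD1 : triSum (Function.update q f (1 / 2)) (insert f F₀) (Function.update τ f 1) K = 0 := by
      nlinarith
    have hD2 : triSum (Function.update q f (1 / 2)) (insert f F₀) (Function.update τ f 2) K = 0 := by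
      nlinarith
    -- the goal: `τ f` is `0`, `1`, `2`, `3` or larger
    have hq0 : Function.update q f (q f) = q := Function.update_eq_self f q
    rcases Nat.lt_or_ge (τ f) 4 with hlt | hge
    · have hcases : τ f = 0 ∨ τ f = 1 ∨ τ f = 2 ∨ τ f = 3 := by omega
      rcases hcases with h0 | h1 | h2 | h3
      · -- type `0`: pinned closed
        have hτ0 : Function.update τ f 0 = τ := by
          rw [← h0]
          exact Function.update_eq_self f τ
        have := triSum_zero q hfF₀ τ K
        rw [hτ0] at this
        rw [this, hA₀]
        ring
      · have hτ1 : Function.update τ f 1 = τ := by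
          rw [← h1]
          exact Function.update_eq_self f τ
        have hj := hfac (q f) 1
        rw [hq0, hτ1] at hj
        rw [hτ1] at hD1
        rw [hD1, zero_mul] at hj
        have h8 : ((1 / 2 : R) ^ 1 * (1 - 1 / 2) ^ (3 - 1)) ≠ 0 := by norm_num
        exact (mul_eq_zero.mp hj).resolve_right h8
      · have hτ2 : Function.update τ f 2 = τ := by
          rw [← h2]
          exact Function.update_eq_self f τ
        have hj := hfac (q f) 2
        rw [hq0, hτ2] at hj
        rw [hτ2] at hD2
        rw [hD2, zero_mul] at hj
        have h8 : ((1 / 2 : R) ^ 2 * (1 - 1 / 2) ^ (3 - 2)) ≠ 0 := by norm_num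
        exact (mul_eq_zero.mp hj).resolve_right h8
      · have hτ3 : Function.update τ f 3 = τ := by
          rw [← h3]
          exact Function.update_eq_self f τ
        have := triSum_three q hfF₀ τ K
        rw [hτ3] at this
        rw [this, hA₃]
        ring
    · exact triSum_eq_zero_of_three_lt q _ τ K (Finset.mem_insert_self f F₀) hge

end Vanish

section Typed

variable {V : Type*} {E : Type*} [Fintype E] [DecidableEq E] {R : Type*}
  [Field R] [LinearOrder R] [IsStrictOrderedRing R]

omit [LinearOrder R] [IsStrictOrderedRing R] in
/-- The typed count only sees the pinned configuration off `F`. -/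
lemma typedCount_congr_pinned (F : Finset E) {z z' : Config E} (h : ∀ g, g ∉ F → z g = z' g)
    (τ : E → ℕ) (K : Config E → Config E → Config E → R) :
    typedCount F z τ K = typedCount F z' τ K := by
  unfold typedCount
  refine Finset.sum_congr rfl fun x _ => Finset.sum_congr rfl fun y _ =>
    Finset.sum_congr rfl fun w _ => ?_
  refine if_congr (and_congr (forall₂_congr fun g hg => by rw [h g hg]) Iff.rfl) rfl rfl

/-- The weight vector `z` off `F`, `1/2` on `F`. -/
noncomputable def halfPin (F : Finset E) (z : Config E) : E → R :=
  fun g => if g ∈ F then (1 / 2 : R) else if z g then 1 else 0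

omit [Fintype E] [LinearOrder R] [IsStrictOrderedRing R] in
/-- `halfPin` is pinned off `F`. -/
lemma halfPin_pinned (F : Finset E) (z : Config E) :
    ∀ g, g ∉ F → halfPin (R := R) F z g = 0 ∨ halfPin (R := R) F z g = 1 := by
  intro g hg
  unfold halfPin
  rw [if_neg hg]
  cases z g <;> simp

omit [Fintype E] [IsStrictOrderedRing R] in
/-- The pinned configuration of `halfPin` is `z` off `F`. -/
lemma pinnedConfig_halfPin (F : Finset E) (z : Config E) :
    ∀ g, g ∉ F → pinnedConfig (halfPin (R := R) F z) g = z g := by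
  intro g hg
  unfold pinnedConfig halfPin
  rw [if_neg hg]
  cases z g <;> simp

omit [Fintype E] in
/-- The Bernstein factors of `halfPin` on `F` are nonzero. -/
lemma halfPin_factors_ne_zero (F : Finset E) (z : Config E) (τ : E → ℕ) :
    (∏ g ∈ F, halfPin (R := R) F z g ^ τ g * (1 - halfPin (R := R) F z g) ^ (3 - τ g)) ≠ 0 := by
  rw [Finset.prod_ne_zero_iff]
  intro g hg
  unfold halfPin
  rw [if_pos hg]
  refine mul_ne_zero (pow_ne_zero _ (by norm_num)) (pow_ne_zero _ (by norm_num))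

/-- **Typed bases of a vanishing cubic form vanish.** -/
theorem typedCount_eq_zero_of_forall (K : Config E → Config E → Config E → R) (τ₀ : E → ℕ)
    (h : ∀ q : E → R, triSum q ∅ τ₀ K = 0) (F : Finset E) (z : Config E) (τ : E → ℕ) :
    typedCount F z τ K = 0 := by
  have hs := triSum_eq_zero_of_forall K τ₀ F (halfPin F z) (fun q' _ => h q') τ
  rw [triSum_pinned_eq (halfPin F z) F (halfPin_pinned F z) τ K,
    typedCount_congr_pinned F (pinnedConfig_halfPin F z) τ K] at hs
  exact (mul_eq_zero.mp hs).resolve_left (halfPin_factors_ne_zero F z τ)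

/-- **Typed bases of a vanishing covariance form vanish**: `(∀ p, Gc p = 0) → typedCount F z τ K₃ = 0`. -/
theorem typedCount_eq_zero_of_Gc_eq_zero (ends : E → Sym2 V) (o a₁ a₂ a₃ b : V)
    (h : ∀ p : E → R, Gc p ends o a₁ a₂ a₃ b = 0) (F : Finset E) (z : Config E) (τ : E → ℕ) :
    typedCount F z τ (K3 ends o a₁ a₂ a₃ b : Config E → Config E → Config E → R) = 0 :=
  typedCount_eq_zero_of_forall (K3 ends o a₁ a₂ a₃ b) (fun _ => 0)
    (fun q => by rw [← hcov_cubic q ends o a₁ a₂ a₃ b (fun _ => 0)]; exact h q) F z τ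

/-- **Typed root coincidence, `a₂ = a₁`.** -/
theorem typedCount_eq_zero_of_a2_eq_a1 (ends : E → Sym2 V) (o a₁ a₃ b : V) (F : Finset E)
    (z : Config E) (τ : E → ℕ) :
    typedCount F z τ (K3 ends o a₁ a₁ a₃ b : Config E → Config E → Config E → R) = 0 :=
  typedCount_eq_zero_of_Gc_eq_zero ends o a₁ a₁ a₃ b
    (fun p => RootCoincidence.Gc_a2_eq_a1 p ends o a₁ a₃ b) F z τ

/-- **Typed root coincidence, `a₃ = a₁`.** -/
theorem typedCount_eq_zero_of_a3_eq_a1 (ends : E → Sym2 V) (o a₁ a₂ b : V) (F : Finset E)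
    (z : Config E) (τ : E → ℕ) :
    typedCount F z τ (K3 ends o a₁ a₂ a₁ b : Config E → Config E → Config E → R) = 0 :=
  typedCount_eq_zero_of_Gc_eq_zero ends o a₁ a₂ a₁ b
    (fun p => RootCoincidence.Gc_a3_eq_a1 p ends o a₁ a₂ b) F z τ

/-- **Typed root coincidence, `o = a₁`.** -/
theorem typedCount_eq_zero_of_o_eq_a1 (ends : E → Sym2 V) (a₁ a₂ a₃ b : V) (F : Finset E)
    (z : Config E) (τ : E → ℕ) :
    typedCount F z τ (K3 ends a₁ a₁ a₂ a₃ b : Config E → Config E → Config E → R) = 0 :=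
  typedCount_eq_zero_of_Gc_eq_zero ends a₁ a₁ a₂ a₃ b
    (fun p => RootCoincidence.Gc_o_eq_a1 p ends a₁ a₂ a₃ b) F z τ

/-- **Typed root coincidence, `b = a₁`.** -/
theorem typedCount_eq_zero_of_b_eq_a1 (ends : E → Sym2 V) (o a₁ a₂ a₃ : V) (F : Finset E)
    (z : Config E) (τ : E → ℕ) :
    typedCount F z τ (K3 ends o a₁ a₂ a₃ a₁ : Config E → Config E → Config E → R) = 0 :=
  typedCount_eq_zero_of_Gc_eq_zero ends o a₁ a₂ a₃ a₁
    (fun p => RootCoincidence.Gc_b_eq_a1 p ends o a₁ a₂ a₃) F z τ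

/-- **Typed root coincidence, `a₃ = a₂`** (through the root swap). -/
theorem typedCount_eq_zero_of_a3_eq_a2 (ends : E → Sym2 V) (o a₁ a₂ b : V) (F : Finset E)
    (z : Config E) (τ : E → ℕ) :
    typedCount F z τ (K3 ends o a₁ a₂ a₂ b : Config E → Config E → Config E → R) = 0 :=
  typedCount_eq_zero_of_Gc_eq_zero ends o a₁ a₂ a₂ b
    (fun p => by rw [← Gc_swap]; exact RootCoincidence.Gc_a3_eq_a1 p ends o a₂ a₁ b) F z τ

/-- **Typed root coincidence, `o = a₂`.** -/
theorem typedCount_eq_zero_of_o_eq_a2 (ends : E → Sym2 V) (a₁ a₂ a₃ b : V) (F : Finset E)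
    (z : Config E) (τ : E → ℕ) :
    typedCount F z τ (K3 ends a₂ a₁ a₂ a₃ b : Config E → Config E → Config E → R) = 0 :=
  typedCount_eq_zero_of_Gc_eq_zero ends a₂ a₁ a₂ a₃ b
    (fun p => by rw [← Gc_swap]; exact RootCoincidence.Gc_o_eq_a1 p ends a₂ a₁ a₃ b) F z τ

/-- **Typed root coincidence, `b = a₂`.** -/
theorem typedCount_eq_zero_of_b_eq_a2 (ends : E → Sym2 V) (o a₁ a₂ a₃ : V) (F : Finset E)
    (z : Config E) (τ : E → ℕ) :
    typedCount F z τ (K3 ends o a₁ a₂ a₃ a₂ : Config E → Config E → Config E → R) = 0 :=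
  typedCount_eq_zero_of_Gc_eq_zero ends o a₁ a₂ a₃ a₂
    (fun p => by rw [← Gc_swap]; exact RootCoincidence.Gc_b_eq_a1 p ends o a₂ a₁ a₃) F z τ

end Typed

end TypedVanish

end Summit.Ventures.PercRepro2
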